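import Literature.IUT.LogVolume.PrincipalArithmeticDivisors
import Literature.NumberTheory.NumberFields.ArchimedeanWeightsRigidity
import HarnessLib

/-!
# The archimedean weights of `deg_F` are forced by `deg_F(APrc(F)) = 0` — [IUTchII] Rmk 4.6.1 "currency exchange"
# at the arithmetic-divisor model

PROOF-ONLY companion (abc-iut cell, layer L6, seat abc-iut-w4-d035 gen 8, piece «RMK461-CURRENCY», row
IUTchII:Rmk4.6.1) of `PrincipalArithmeticDivisors.lean` ([GenEll] §1 / [IUTchIV] Def 1.9 (i): `ADiv_ℝ(F)`, `deg_F`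
with weights `log q_v` at `v ∤ ∞` and `1` at `v | ∞`, principal divisors `ADiv(f)`, the product formula
`degF_principal`). Over the classical rigidity theorem `Literature.NumberTheory.NumberFields.archWeights_eq_one`
(Dirichlet's unit theorem), this file records the converse of the product formula in the tree's vocabulary:

* `archWeights_eq_one_of_principal`: if archimedean weights `λ_w` balance the nonarchimedean degree
  `Σ_{v ∈ T} ord_v(f)·log q_v` of EVERY principal divisor against `Σ_w λ_w·[F_w:ℝ]·log|f|_w`, then `λ_w = 1`;
* `archWeights_eq_one_of_reweightedDeg_principal` / `reweightedDeg_eq_degF`: a re-weighted degree map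
  `ADiv_ℝ(F) → ℝ` with the printed nonarchimedean weights `log q_v` and ARBITRARY archimedean weights `λ_w` that
  kills every principal divisor has `λ_w = 1`, i.e. IS `deg_F`.

This is the mathematical content, at the number-field / arithmetic-divisor model of the global realified
Frobenioid `𝒞⊩_mod` ([IUTchI] Ex 3.5; rational-function monoid `F^×`, principal divisors), of S. Mochizuki,
*Inter-universal Teichmüller theory II*, Remark 4.6.1 (kurims Dec-2020 manuscript p. 140 l. 15–27): "if one
reconstructs both `Ψ^ss_cns(‡𝔉⊢) ⥲ Ψ^ss_cns(‡𝔇⊢)` and `‡𝒞⊩ ⥲ 𝒟⊩(‡𝔇⊢)` in a compatible fashion, then the distinguished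
elements at `v ∈ 𝕍^arc` may be computed [in the evident fashion] from the distinguished elements at `v ∈ 𝕍^non`,
together with the structure of the global Frobenioids `‡𝒞⊩`, `𝒟⊩(‡𝔇⊢)`, i.e., by thinking of these global Frobenioids
as «devices for currency exchange» between the various «local currencies» constituted by the divisor monoids at
the various `v ∈ 𝕍` [cf. [IUTchI], Remark 3.5.1, (ii)]" [cite: Mochizuki2012, Rmk 4.6.1 p.140]: the nonarchimedean
"currencies" (`ord_v`, `q_v`) are intrinsic (Rmk 4.6.1, first clause; `Nat.addEquiv_eq_refl` in
`GlobalGaussianFrobenioidsRemarksProofs`), the archimedean ones are not (`exists_mulEquiv_unitDisc_not_associated`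
there), and the global structure FORCES the archimedean exchange rates. Classical; nothing here bears on
[IUTchIII] Cor. 3.12 or asserts a disputed claim.
-/

noncomputable section

namespace Literature.IUT.LogVolume

open NumberField IsDedekindDomain Finset

variable {F : Type*} [Field F] [NumberField F]

/-- **[IUTchII] Rmk 4.6.1, "currency exchange", sum form.** If archimedean weights `λ_w` balance, for EVERY
`f ∈ F^×` and every finite set `T` of finite places containing the support of `ADiv(f)`, the nonarchimedean degree
against the re-weighted archimedean one — `Σ_{v ∈ T} ord_v(f)·log q_v = Σ_w λ_w·[F_w:ℝ]·log|f|_w` — then `λ_w = 1`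
for every archimedean `w` (`archWeights_eq_one` + the product formula `sum_ord_mul_logNorm_eq_sum_mult_log`).
[cite: Mochizuki2012, Rmk 4.6.1 p.140] -/
theorem archWeights_eq_one_of_principal (lam : InfinitePlace F → ℝ)
    (h : ∀ f : F, f ≠ 0 → ∀ T : Finset (HeightOneSpectrum (𝓞 F)), {v | ord F v f ≠ 0} ⊆ (T : Set _) →
      ∑ v ∈ T, (ord F v f : ℝ) * logNorm F v =
        ∑ w : InfinitePlace F, lam w * ((w.mult : ℝ) * Real.log (w f))) :
    ∀ w, lam w = 1 := by
  refine Literature.NumberTheory.NumberFields.archWeights_eq_one lam fun f hf => ?_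
  have hT : {v | ord F v f ≠ 0} ⊆ ((finite_setOf_ord_ne_zero F f).toFinset : Set _) := by
    intro v hv
    simpa using hv
  rw [← h f hf _ hT, sum_ord_mul_logNorm_eq_sum_mult_log hf hT]

/-- The re-weighted degree of a principal divisor, computed: for archimedean weights `λ` and the printed
nonarchimedean weights `log q_v`,
`Σ_v ADiv(f)_v · weight_v = Σ_{v ∈ supp} ord_v(f)·log q_v − Σ_w λ_w·[F_w:ℝ]·log|f|_w`.
[cite: Mochizuki2012, Rmk 4.6.1 p.140] -/
theorem reweightedDeg_principal (lam : InfinitePlace F → ℝ) (f : F) :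
    (ADivisor.principal f).sum (fun p c => c * Sum.elim lam (fun v => logNorm F v) p) =
      ∑ v ∈ (ADivisor.principalNon f).support, (ord F v f : ℝ) * logNorm F v -
        ∑ w : InfinitePlace F, lam w * ((w.mult : ℝ) * Real.log (w f)) := by
  rw [ADivisor.principal, Finsupp.sum_sumElim]
  have harc : (ADivisor.principalArc f).sum (fun w c => c * Sum.elim lam (fun v => logNorm F v) (Sum.inl w)) =
      ∑ w : InfinitePlace F, -((w.mult : ℝ) * Real.log (w f)) * lam w := by
    rw [Finsupp.sum_fintype _ _ (fun _ => by simp)]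
    simp [ADivisor.principalArc]
  have hnon : (ADivisor.principalNon f).sum (fun v c => c * Sum.elim lam (fun v => logNorm F v) (Sum.inr v)) =
      ∑ v ∈ (ADivisor.principalNon f).support, (ord F v f : ℝ) * logNorm F v := by
    rw [Finsupp.sum]
    refine Finset.sum_congr rfl fun v _ => ?_
    simp [ADivisor.principalNon, Finsupp.ofSupportFinite_coe]
  change (ADivisor.principalArc f).sum (fun w c => c * Sum.elim lam (fun v => logNorm F v) (Sum.inl w)) +
      (ADivisor.principalNon f).sum (fun v c => c * Sum.elim lam (fun v => logNorm F v) (Sum.inr v)) = _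
  rw [harc, hnon, add_comm, sub_eq_add_neg, ← Finset.sum_neg_distrib]
  congr 1
  exact Finset.sum_congr rfl fun w _ => by ring

/-- **[IUTchII] Rmk 4.6.1, "currency exchange", degree form.** A re-weighted degree map on `ADiv_ℝ(F)` with the
printed nonarchimedean weights `log q_v` and ARBITRARY archimedean weights `λ_w` that vanishes on every principal
divisor `ADiv(f)`, `f ∈ F^×` — i.e. that "descends to `ADiv(F)/APrc(F)`" as `deg_F` does — has `λ_w = 1` for every
`w`: the archimedean weights are not a choice. [cite: Mochizuki2012, Rmk 4.6.1 p.140] -/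
theorem archWeights_eq_one_of_reweightedDeg_principal (lam : InfinitePlace F → ℝ)
    (h : ∀ f : F, f ≠ 0 →
      (ADivisor.principal f).sum (fun p c => c * Sum.elim lam (fun v => logNorm F v) p) = 0) :
    ∀ w, lam w = 1 := by
  refine Literature.NumberTheory.NumberFields.archWeights_eq_one lam fun f hf => ?_
  have hT : {v | ord F v f ≠ 0} ⊆ ((ADivisor.principalNon f).support : Set _) := by
    intro v hv
    simp only [Finset.mem_coe, Finsupp.mem_support_iff, ADivisor.principalNon,
      Finsupp.ofSupportFinite_coe, ne_eq, Int.cast_eq_zero]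
    exact hv
  have h0 := h f hf
  rw [reweightedDeg_principal, sub_eq_zero, sum_ord_mul_logNorm_eq_sum_mult_log hf hT] at h0
  exact h0.symm

/-- **Uniqueness of `deg_F`.** Consequently such a re-weighted degree map coincides with `deg_F` on ALL of
`ADiv_ℝ(F)` ([GenEll] §1 / [IUTchIV] Def 1.9 (i): weights `log q_v`, `1`): the printed archimedean weight `1` is
the only one compatible with the product formula. [cite: Mochizuki2012, Rmk 4.6.1 p.140] -/
theorem reweightedDeg_eq_degF (lam : InfinitePlace F → ℝ)
    (h : ∀ f : F, f ≠ 0 →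
      (ADivisor.principal f).sum (fun p c => c * Sum.elim lam (fun v => logNorm F v) p) = 0)
    (a : ADivisor F) :
    a.sum (fun p c => c * Sum.elim lam (fun v => logNorm F v) p) = degF F a := by
  have hw : Sum.elim lam (fun v => logNorm F v) = degWeight F := by
    funext p
    rcases p with w | v
    · rw [Sum.elim_inl, degWeight_inl, archWeights_eq_one_of_reweightedDeg_principal lam h w]
    · rfl
  rw [hw, degF_apply]

end Literature.IUT.LogVolume
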